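import Summits.QuantumFields.BalabanUV.T4Continuum.Support.DirichletMorreyDecayBlock
import Summits.QuantumFields.BalabanUV.Beta.GAN24.DirichletBoxCompression

/-!
# `BalabanUV.T4Continuum.Support.DirichletMorreyDecaySolExt` — NE2 (node U1a) formalisation swarm, sub-row `T4-U1a.S-NE2-D1-DIRICHLET°`,
# supplier item «Δ1-HOLEFILL» (junction, END OF THE BRICK): MORREY DECAY OF THE REGION DIRICHLET SOLUTION IN ENERGY UNITS — for the
# zero-extended `U = 1` scalar Dirichlet solution `u = solExt n M a′ (blockReg n M S) w` of gan24-p2's `DirichletBoxCompression`, at the lower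
# corner of any block `β₀` with an exterior neighbour `cornerBlock β₀ σ ∉ S`:
# `(local energy of u in the cube of side 4m) ≤ θ_d^J · (γ′⁻¹ + 32(1+2^d)(1+(a′γ′⁻¹)²)) · ‖w‖²`, `4·2^J m ≤ 2n`
# (unit b2b-balaban-t4-ne2-formalise-leaf-08, gen 6, file 10)

HONEST FRAMING.  Rung (B)+1 bookkeeping at MODEL level (U = 1 scalar layer `Δ′ = Δ + a′Π′`, finite torus); [folklore] lattice De Giorgi–Widman;
NE2 (U1a) is NOT proved by this file; spine PROVED 0/9 unchanged; NOT infinite volume, NOT the mass gap, NOT Clay.  HONEST DEPENDENCY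
(verbatim): «continuum YM on T⁴ ⇐ BetaPertH ∧ nine spine estimates (0/9 proved); BetaPertH ⇐ (D1) ∧ (D4) ∧ CAP+tail; G-an2-4 gates asym, D1
and NE2/3/4.»

WHAT THIS FILE PROVES (0 sorry).  On `Tor (fine n M)` with lattice factor `c = n`:
 * `normSq_mul_dirOn_eq` ∕ `normSq_mul_dirOn_le_dirichlet`: `n²·dirOn univ (z ∘ chart b)` IS the energy `Σ_ν Σ_{cube bonds} ‖(∂_νz)(x)‖²` of `z` on
   the bonds of the charted cube, hence `≤ dirichlet n M z = Σ_ν ‖∂_νz‖²`; `sum_chart_restrict_le`: the charted source mass is at most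
   `Σ_{x ∈ Ω} ‖(Δz)(x)‖²`;
 * **`local_energy_decay_solExt`** (THE END): `d ≥ 2`, `a′ > 0`, a block set `S`, a block `β₀`, a sign pattern `σ` with `cornerBlock β₀ σ ∉ S`,
   scales `m ≥ 1`, `4m = n₀ + 1`, `K = 2^J m`, `2K ≤ n`, `4K = nn + 1 ≤ n·M ν`; for every datum `w` on `blockReg n M S` and
   `u = solExt n M a′ (blockReg n M S) w`:
   `n²·dirOn univ (u ∘ chart (shift (2K − 2m) (cornerBase β₀ K))) ≤ θ_d^J·(γ′⁻¹ + 32(1 + 2^d)(1 + (a′γ′⁻¹)²))·‖w‖²`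
   — `DirichletMorreyDecayBlock.morrey_decay_blockReg` + gan24-p2's `dirichlet_solExt_le` (`Σ‖∂u‖² ≤ γ′⁻¹‖w‖²`) and `sum_normSq_LapS_solExt_le`
   (`Σ_Ω‖Δu‖² ≤ 2(1+(a′γ′⁻¹)²)‖w‖²`) BY NAME, `K² ≤ n²/4`.  Reading: with `θ_d^J = (4m / 4K)^{2s_d}`, `2s_d = log₂ θ_d⁻¹ > 0`, the Dirichlet energy of
   the region solution within `2m` fine sites of a boundary vertex that has an exterior block is `≲ (m/K)^{2s_d}·‖w‖²` — MORREY DECAY, uniformly in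
   the torus, `n`, the region and the vertex.

ABSOLUTE RULE (cell, verbatim): «No internally-minted statement may enter as a cited fact. Every hypothesis is either kernel-proved in
this package or a verbatim quotation of a PUBLISHED theorem with page reference. The manuscript(s) under audit are NOT citable for
their own disputed steps — they are the thing under adjudication; programme-internal (2001/route/tribunal) claims are never citable.»
[folklore]; no definitions; no `def … : Prop` fact.  NOT CLAIMED: the assembly H-E/H-F (the two-level law on conflict patches); NE2; NE3.
-/

noncomputable section

open scoped BigOperators ComplexConjugate Matrix
open Finset

namespace Summit.QuantumFields.BalabanUV.T4Continuum.DirichletMorreyDecaySolExt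

open Literature.MathematicalPhysics.QuantumFieldTheory.Balaban1983to89.B5Prop11Plancherel (Tor fine unitVec)
open Literature.MathematicalPhysics.QuantumFieldTheory.Balaban1983to89.B5Prop11Lower (nsq nsq_nonneg)
open Literature.MathematicalPhysics.QuantumFieldTheory.Balaban1983to89.B5Action121 (sdiff LapS sdiff_mulVec)
open Literature.MathematicalPhysics.QuantumFieldTheory.Balaban1983to89.Beta.CoordCubePoincare (stepUp)
open Summit.QuantumFields.BalabanUV.T4Continuum.ScalarAveragedPropagator (gammaPs gammaPs_pos dirichlet)
open Summit.QuantumFields.BalabanUV.T4Continuum.DirichletDirectionalBesov (restrictTo nsqOn nsq_restrictTo)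
open Summit.QuantumFields.BalabanUV.T4Continuum.CoordSlabPoincare (dirOn val_stepUp)
open Summit.QuantumFields.BalabanUV.T4Continuum.DirichletHoleFillingCutoff (chart chart_stepUp sum_chart_le_sum)
open Summit.QuantumFields.BalabanUV.T4Continuum.DirichletHoleFilling (theta theta_lt_one)
open Summit.QuantumFields.BalabanUV.T4Continuum.DirichletMorreyDecay (shift)
open Summit.QuantumFields.BalabanUV.T4Continuum.DirichletMorreyDecayBlock (cornerBlock cornerBase morrey_decay_blockReg)
open Summit.QuantumFields.BalabanUV.Beta.GAN24.DirichletBoxTrace (blockReg)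
open Summit.QuantumFields.BalabanUV.Beta.GAN24.DirichletBoxCompression (solExt solExt_apply_of_not dirichlet_solExt_le sum_normSq_LapS_solExt_le)

variable {d : ℕ} (n : ℕ) [NeZero n] (M : Fin d → ℕ) [hM : ∀ μ, NeZero (M μ)]

/-! ## §1 The charted Dirichlet form in energy units -/

/-- **`n²·dirOn univ (z ∘ chart b) = Σ_ν Σ_{j : j ν ≠ last} ‖(∂_ν z)(chart b j)‖²`** — the LOCAL ENERGY of `z` on the bonds of the charted
cube (lattice factor `c = n`). [folklore] -/
theorem normSq_mul_dirOn_eq {nn : ℕ} (b : Tor (fine n M)) (z : Tor (fine n M) → ℂ) :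
    (n : ℝ) ^ 2 * dirOn (univ : Finset (Fin d → Fin (nn + 1))) (z ∘ chart (fine n M) (n := nn) b)
      = ∑ ν : Fin d, ∑ j ∈ univ.filter (fun j : Fin d → Fin (nn + 1) => j ν ≠ Fin.last nn),
          ‖(sdiff (fine n M) (n : ℂ) ν *ᵥ z) (chart (fine n M) b j)‖ ^ 2 := by
  rw [dirOn, Finset.mul_sum]
  refine Finset.sum_congr rfl fun ν _ => ?_
  rw [Finset.mul_sum]
  have hset : univ.filter (fun y : Fin d → Fin (nn + 1) => y ν ≠ Fin.last nn ∧ y ∈ (univ : Finset (Fin d → Fin (nn + 1)))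
        ∧ stepUp y ν ∈ (univ : Finset (Fin d → Fin (nn + 1))))
      = univ.filter (fun y : Fin d → Fin (nn + 1) => y ν ≠ Fin.last nn) := by
    ext y; simp
  rw [hset]
  refine Finset.sum_congr rfl fun j hj => ?_
  rw [mem_filter] at hj
  rw [sdiff_mulVec, ← chart_stepUp (fine n M) b hj.2, norm_mul, mul_pow, Complex.norm_natCast, Function.comp_apply,
    Function.comp_apply]

/-- hence `n²·dirOn univ (z ∘ chart b) ≤ dirichlet n M z = Σ_ν ‖∂_ν z‖²` (the cube fits: `nn + 1 ≤ n·M ν`). [folklore] -/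
theorem normSq_mul_dirOn_le_dirichlet {nn : ℕ} (hN' : ∀ ν, nn + 1 ≤ fine n M ν) (b : Tor (fine n M)) (z : Tor (fine n M) → ℂ) :
    (n : ℝ) ^ 2 * dirOn (univ : Finset (Fin d → Fin (nn + 1))) (z ∘ chart (fine n M) (n := nn) b) ≤ dirichlet n M z := by
  rw [normSq_mul_dirOn_eq, dirichlet]
  refine Finset.sum_le_sum fun ν _ => ?_
  exact sum_chart_le_sum (fine n M) b hN' _ (G := fun x => ‖(sdiff (fine n M) (n : ℂ) ν *ᵥ z) x‖ ^ 2) (fun _ => sq_nonneg _)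

/-- the charted SOURCE MASS is at most the mass of `Δz` on the region: `Σ_j ‖(1_ΩΔz)(chart b j)‖² ≤ Σ_{x ∈ Ω} ‖(Δz)(x)‖²`. [folklore] -/
theorem sum_chart_restrict_le {nn : ℕ} (hN' : ∀ ν, nn + 1 ≤ fine n M ν) (b : Tor (fine n M)) (Ω : Tor (fine n M) → Prop) [DecidablePred Ω]
    (z : Tor (fine n M) → ℂ) :
    ∑ j : Fin d → Fin (nn + 1), ‖restrictTo Ω (LapS (fine n M) (n : ℂ) *ᵥ z) (chart (fine n M) b j)‖ ^ 2
      ≤ ∑ a : {x // Ω x}, ‖(LapS (fine n M) (n : ℂ) *ᵥ z) a‖ ^ 2 := by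
  have h := sum_chart_le_sum (fine n M) b hN' univ (G := fun x => ‖restrictTo Ω (LapS (fine n M) (n : ℂ) *ᵥ z) x‖ ^ 2) (fun _ => sq_nonneg _)
  refine h.trans (le_of_eq ?_)
  have := nsq_restrictTo Ω (LapS (fine n M) (n : ℂ) *ᵥ z)
  rw [nsq, nsqOn] at this
  exact this

/-! ## §2 The END: local energy decay of the region Dirichlet solution -/

/-- **MORREY DECAY OF THE REGION DIRICHLET SOLUTION, IN ENERGY UNITS.**  `d ≥ 2`, `a′ > 0`; `S` a set of unit blocks, `β₀` a block and `σ` a sign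
pattern with `cornerBlock β₀ σ ∉ S` (an exterior block at the lower corner of `β₀`); `m ≥ 1`, `4m = n₀ + 1`, `K = 2^J m`, `2K ≤ n`, `4K = nn + 1 ≤ n·M ν`.
For every datum `w` and `u = solExt n M a′ (blockReg n M S) w`:
`n²·dirOn univ (u ∘ chart (shift (2K − 2m)(cornerBase β₀ K))) ≤ θ_d^J·(γ′⁻¹ + 32(1+2^d)(1+(a′γ′⁻¹)²))·‖w‖²`. [folklore] -/
theorem local_energy_decay_solExt (hd : 2 ≤ d) {a' : ℝ} (ha' : 0 < a') (S : Tor M → Prop) [DecidablePred S] (β₀ : Tor M) (σ : Fin d → Bool)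
    (hβ : ¬ S (cornerBlock M β₀ σ)) {m : ℕ} (hm : 1 ≤ m) {n₀ : ℕ} (hn₀ : 4 * m = n₀ + 1) (J : ℕ) {nn : ℕ} (hnn : 4 * (2 ^ J * m) = nn + 1)
    (hK : 2 * (2 ^ J * m) ≤ n) (hN' : ∀ ν, nn + 1 ≤ fine n M ν) (w : {x // blockReg n M S x} → ℂ) :
    (n : ℝ) ^ 2 * dirOn (univ : Finset (Fin d → Fin (n₀ + 1)))
        (solExt n M a' (blockReg n M S) w ∘ chart (fine n M) (n := n₀) (shift (fine n M) (2 * 2 ^ J * m - 2 * m) (cornerBase n M β₀ (2 ^ J * m))))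
      ≤ theta d ^ J * ((gammaPs d a')⁻¹ + 32 * (1 + 2 ^ d) * (1 + (a' * (gammaPs d a')⁻¹) ^ 2)) * nsq w := by
  set u := solExt n M a' (blockReg n M S) w with hu
  set K := 2 ^ J * m with hKdef
  have hnpos : (0 : ℝ) < n := by exact_mod_cast Nat.pos_of_ne_zero (NeZero.ne n)
  have hn2 : (0 : ℝ) < (n : ℝ) ^ 2 := by positivity
  have hc : ((n : ℕ) : ℂ) ≠ 0 := by exact_mod_cast NeZero.ne n
  have hz : ∀ x, ¬ blockReg n M S x → u x = 0 := fun x hx => solExt_apply_of_not n M a' _ w hx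
  have hdec := morrey_decay_blockReg n M hd hc S hz β₀ σ hβ hm hn₀ J hnn hK hN'
  have hθ := theta_lt_one d
  have hθJ : 0 ≤ theta d ^ J := pow_nonneg (by linarith [hθ.1]) J
  have hγ := (gammaPs_pos (d := d) (a' := a')).1
  -- the two global budgets of gan24-p2
  have hE : (n : ℝ) ^ 2 * dirOn (univ : Finset (Fin d → Fin (nn + 1))) (u ∘ chart (fine n M) (n := nn) (cornerBase n M β₀ K))
      ≤ (gammaPs d a')⁻¹ * nsq w :=
    (normSq_mul_dirOn_le_dirichlet n M hN' _ u).trans (dirichlet_solExt_le n M a' _ ha' w)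
  have hS : ∑ j : Fin d → Fin (nn + 1), ‖restrictTo (blockReg n M S) (LapS (fine n M) (n : ℂ) *ᵥ u) (chart (fine n M) (cornerBase n M β₀ K) j)‖ ^ 2
      ≤ 2 * (1 + (a' * (gammaPs d a')⁻¹) ^ 2) * nsq w :=
    (sum_chart_restrict_le n M hN' _ (blockReg n M S) u).trans (sum_normSq_LapS_solExt_le n M a' _ ha' w)
  have hw := nsq_nonneg w
  have hKn : ((K : ℕ) : ℝ) ^ 2 ≤ (n : ℝ) ^ 2 / 4 := by
    have : (2 * K : ℕ) ≤ n := hK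
    have h2 : 2 * ((K : ℕ) : ℝ) ≤ n := by exact_mod_cast this
    nlinarith
  have hnorm : ‖((n : ℕ) : ℂ)‖ = (n : ℝ) := Complex.norm_natCast n
  rw [hnorm] at hdec
  -- multiply the decay by `n²` and insert the budgets
  have h1 := mul_le_mul_of_nonneg_left hdec hn2.le
  refine h1.trans ?_
  have hsrc0 : 0 ≤ ∑ j : Fin d → Fin (nn + 1),
      ‖restrictTo (blockReg n M S) (LapS (fine n M) (n : ℂ) *ᵥ u) (chart (fine n M) (cornerBase n M β₀ K) j)‖ ^ 2 :=
    Finset.sum_nonneg fun _ _ => sq_nonneg _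
  have h2 : (n : ℝ) ^ 2 * (64 * (1 + 2 ^ d) * ((K : ℕ) : ℝ) ^ 2 / (n : ℝ) ^ 4
        * ∑ j : Fin d → Fin (nn + 1), ‖restrictTo (blockReg n M S) (LapS (fine n M) (n : ℂ) *ᵥ u) (chart (fine n M) (cornerBase n M β₀ K) j)‖ ^ 2)
      ≤ 32 * (1 + 2 ^ d) * (1 + (a' * (gammaPs d a')⁻¹) ^ 2) * nsq w := by
    have e : (n : ℝ) ^ 2 * (64 * (1 + 2 ^ d) * ((K : ℕ) : ℝ) ^ 2 / (n : ℝ) ^ 4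
          * ∑ j : Fin d → Fin (nn + 1), ‖restrictTo (blockReg n M S) (LapS (fine n M) (n : ℂ) *ᵥ u) (chart (fine n M) (cornerBase n M β₀ K) j)‖ ^ 2)
        = (64 * (1 + 2 ^ d)) * (((K : ℕ) : ℝ) ^ 2 / (n : ℝ) ^ 2)
          * ∑ j : Fin d → Fin (nn + 1), ‖restrictTo (blockReg n M S) (LapS (fine n M) (n : ℂ) *ᵥ u) (chart (fine n M) (cornerBase n M β₀ K) j)‖ ^ 2 := by
      field_simp
    rw [e]
    have hq : ((K : ℕ) : ℝ) ^ 2 / (n : ℝ) ^ 2 ≤ 1 / 4 := by rw [div_le_iff₀ hn2]; linarith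
    calc (64 * (1 + 2 ^ d)) * (((K : ℕ) : ℝ) ^ 2 / (n : ℝ) ^ 2)
          * ∑ j : Fin d → Fin (nn + 1), ‖restrictTo (blockReg n M S) (LapS (fine n M) (n : ℂ) *ᵥ u) (chart (fine n M) (cornerBase n M β₀ K) j)‖ ^ 2
        ≤ (64 * (1 + 2 ^ d)) * (1 / 4) * (2 * (1 + (a' * (gammaPs d a')⁻¹) ^ 2) * nsq w) :=
          mul_le_mul (mul_le_mul_of_nonneg_left hq (by positivity)) hS hsrc0 (by positivity)
      _ = _ := by ring
  calc (n : ℝ) ^ 2 * (theta d ^ J * (dirOn univ (u ∘ chart (fine n M) (cornerBase n M β₀ K))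
          + 64 * (1 + 2 ^ d) * ((K : ℕ) : ℝ) ^ 2 / (n : ℝ) ^ 4
            * ∑ j : Fin d → Fin (nn + 1), ‖restrictTo (blockReg n M S) (LapS (fine n M) (n : ℂ) *ᵥ u) (chart (fine n M) (cornerBase n M β₀ K) j)‖ ^ 2))
      = theta d ^ J * ((n : ℝ) ^ 2 * dirOn univ (u ∘ chart (fine n M) (cornerBase n M β₀ K))
          + (n : ℝ) ^ 2 * (64 * (1 + 2 ^ d) * ((K : ℕ) : ℝ) ^ 2 / (n : ℝ) ^ 4
            * ∑ j : Fin d → Fin (nn + 1), ‖restrictTo (blockReg n M S) (LapS (fine n M) (n : ℂ) *ᵥ u) (chart (fine n M) (cornerBase n M β₀ K) j)‖ ^ 2)) := by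
        ring
    _ ≤ theta d ^ J * ((gammaPs d a')⁻¹ * nsq w + 32 * (1 + 2 ^ d) * (1 + (a' * (gammaPs d a')⁻¹) ^ 2) * nsq w) :=
        mul_le_mul_of_nonneg_left (add_le_add hE h2) hθJ
    _ = _ := by ring

end Summit.QuantumFields.BalabanUV.T4Continuum.DirichletMorreyDecaySolExt

end
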